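import Mathlib
import Summits.AtomisticToContinuum.Crystallization.Theorems.GappedShellCensusCleanLimitsHaveWindowsLayeredCuboct

/-!
# Exactly layered shells ⇒ exactly layered set, file 3: the hexagon lemma

Crux `GappedShellCensus.CleanLimitsHaveWindows` (stmt-AtomisticToContinuum-15932), line `Sketch`, support for
`stub_layeredOfExactShells`.  Anchor `stub_hexagonShell`: a slot-model shell `p + A' M` (any frame, type and
parameters) that contains the regular hexagon `p ± A u, p ± A v, p ± A (u - v)` of spacing `a'` of ANOTHER frame `A`
is a slot model of spacing `a'` in a frame `B` with `B e₃ = A e₃` and `B = ±A` on the layer plane.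

Proof.  The six points are `A'`-images of six code points, antipodal in pairs and with `u - v` the difference of
`u` and `v`; comparing coordinates, either (HEX) the codes of `A u`, `A v` are adjacent codes of level `0`, or a cap
code is antipodal to a code, which forces cubic type, equal and ideal heights — a perfect cuboctahedron, settled by
`cuboct_marked_edge`.  In case (HEX) the unit normal `A' e₃` is `±A e₃`, every code point is an integer-thirds
combination of the two hexagon code points and `e₃`, and the 12 × 2 × 2 re-expansions of the code set in the new
basis are again the code set or its half turn (`laHex_transport`, `decide`).
-/

noncomputable section

namespace Summit.AtomisticToContinuum.Crystallization.Theorems.CleanHull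

open Literature.MathematicalPhysics.StatisticalMechanics

/-! ## Combinatorics of the change of hexagon basis (`decide`) -/

/-- The sign of a Boolean. [folklore] -/
def laSgn (s : Bool) : ℤ := if s then 1 else -1

/-- `(i, j)` is an ordered pair of level-`0` codes whose difference is again a level-`0` code. [folklore] -/
def laHexPair (t : Bool) (i j : Fin 12) : Bool :=
  ((laCode t i).2.2 == 0) && ((laCode t j).2.2 == 0) &&
    (List.finRange 12).any fun k => ((laCode t k).2.2 == 0) &&
      ((laCode t k).1 == (laCode t i).1 - (laCode t j).1) && ((laCode t k).2.1 == (laCode t i).2.1 - (laCode t j).2.1)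

/-- The code of slot `m` re-expanded in the hexagon basis `(i, j)` with level sign `s` is `c'`:
`3 · planar(m) = c'₁ · planar(i) + c'₂ · planar(j)`, `c'₃ = ± level(m)`. [folklore] -/
def laHexRel (t s : Bool) (i j m : Fin 12) (c' : ℤ × ℤ × ℤ) : Bool :=
  (3 * (laCode t m).1 == c'.1 * (laCode t i).1 + c'.2.1 * (laCode t j).1) &&
  (3 * (laCode t m).2.1 == c'.1 * (laCode t i).2.1 + c'.2.1 * (laCode t j).2.1) &&
  (c'.2.2 == laSgn s * (laCode t m).2.2)

/-- The half turn on codes. [folklore] -/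
def laRpi (c : ℤ × ℤ × ℤ) : ℤ × ℤ × ℤ := (-c.1, -c.2.1, c.2.2)

/-- **The 48 re-expansions of each code set in a hexagon basis are the code set or its half turn.** [folklore] -/
theorem laHex_transport (t s : Bool) (i j : Fin 12) (h : laHexPair t i j = true) :
    ((∀ m : Fin 12, ∃ m' : Fin 12, laHexRel t s i j m (laCode t m') = true) ∧
      (∀ m' : Fin 12, ∃ m : Fin 12, laHexRel t s i j m (laCode t m') = true)) ∨
    ((∀ m : Fin 12, ∃ m' : Fin 12, laHexRel t s i j m (laRpi (laCode t m')) = true) ∧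
      (∀ m' : Fin 12, ∃ m : Fin 12, laHexRel t s i j m (laRpi (laCode t m')) = true)) := by
  revert h i j s t
  decide +kernel

/-- No hexagonal-type code is antipodal in the plane to a cap code. [folklore] -/
theorem laCodeH_no_anticap (i i' : Fin 12) (h : (laCodeH i).2.2 ≠ 0) (h1 : (laCodeH i').1 = -(laCodeH i).1)
    (h2 : (laCodeH i').2.1 = -(laCodeH i).2.1) : False := by
  revert h h1 h2 i i'
  decide

/-! ## Coordinates -/

/-- Coordinates with respect to `u, v, e₃` are unique (`a' ≠ 0`). [folklore] -/
theorem la_coords {a' : ℝ} (ha' : a' ≠ 0) {x y t x' y' t' : ℝ}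
    (h : x • triangularVec₁ a' + y • triangularVec₂ a' + t • layerNormal 1 =
      x' • triangularVec₁ a' + y' • triangularVec₂ a' + t' • layerNormal 1) : x = x' ∧ y = y' ∧ t = t' := by
  have h0 := congrArg (fun v : EuclideanSpace ℝ (Fin 3) => v 0) h
  have h1 := congrArg (fun v : EuclideanSpace ℝ (Fin 3) => v 1) h
  have h2 := congrArg (fun v : EuclideanSpace ℝ (Fin 3) => v 2) h
  simp only [triangularVec₁, triangularVec₂, layerNormal, PiLp.add_apply, PiLp.smul_apply, smul_eq_mul] at h0 h1 h2
  simp at h0 h1 h2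
  have e1 : y = y' := h1.resolve_right ha'
  refine ⟨?_, e1, h2⟩
  rw [e1] at h0
  have : (x - x') * a' = 0 := by linarith
  have := (mul_eq_zero.1 this).resolve_right ha'; linarith

/-- The code point in coordinates, and its negative. [folklore] -/
theorem laPt_coords (a' kp km : ℝ) (c : ℤ × ℤ × ℤ) :
    laPt a' kp km c = ((c.1 : ℝ) / 3) • triangularVec₁ a' + ((c.2.1 : ℝ) / 3) • triangularVec₂ a' +
      laHt kp km c.2.2 • layerNormal 1 ∧
    -laPt a' kp km c = (-(c.1 : ℝ) / 3) • triangularVec₁ a' + (-(c.2.1 : ℝ) / 3) • triangularVec₂ a' +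
      (-laHt kp km c.2.2) • layerNormal 1 := by
  refine ⟨rfl, ?_⟩
  simp only [laPt]
  module

/-- The half turn on code points. [folklore] -/
theorem laHalfTurn_laPt (a' kp km : ℝ) (c : ℤ × ℤ × ℤ) :
    laHalfTurn (laPt a' kp km c) = laPt a' kp km (laRpi c) := by
  obtain ⟨he, hu, hv⟩ := laHalfTurn_basis a'
  simp only [laPt, laRpi, map_add, map_smul, he, hu, hv, Int.cast_neg]
  module

/-- **The unit normals of the plane `A u, A v` are `± A e₃`.** [folklore] -/
theorem unit_normal_eq {a' : ℝ} (ha' : 0 < a') (A : EuclideanSpace ℝ (Fin 3) →ₗᵢ[ℝ] EuclideanSpace ℝ (Fin 3))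
    (n : EuclideanSpace ℝ (Fin 3)) (hn : ‖n‖ = 1) (hu : inner ℝ n (A (triangularVec₁ a')) = 0)
    (hv : inner ℝ n (A (triangularVec₂ a')) = 0) : n = A (layerNormal 1) ∨ n = -A (layerNormal 1) := by
  obtain ⟨n', rfl⟩ : ∃ n', A n' = n :=
    ⟨(A.toLinearIsometryEquiv rfl).symm n, (A.toLinearIsometryEquiv rfl).apply_symm_apply n⟩
  rw [A.norm_map] at hn
  rw [A.inner_map_map] at hu hv
  have e1 : n' 0 ^ 2 + n' 1 ^ 2 + n' 2 ^ 2 = 1 := by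
    have := hn; rw [← sq_eq_sq₀ (norm_nonneg _) zero_le_one, EuclideanSpace.norm_sq_eq, Fin.sum_univ_three] at this
    simpa [Real.norm_eq_abs, sq_abs] using this
  have hu' : inner ℝ n' (triangularVec₁ a') = a' * n' 0 := by
    simp [EuclideanSpace.inner_eq_star_dotProduct, triangularVec₁, dotProduct, Fin.sum_univ_three]
  have hv' : inner ℝ n' (triangularVec₂ a') = a' / 2 * n' 0 + a' * Real.sqrt 3 / 2 * n' 1 := by
    simp [EuclideanSpace.inner_eq_star_dotProduct, triangularVec₂, dotProduct, Fin.sum_univ_three]; try ring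
  have f0 : n' 0 = 0 := by
    rw [hu'] at hu; exact (mul_eq_zero.1 hu).resolve_left ha'.ne'
  have f1 : n' 1 = 0 := by
    rw [hv', f0] at hv
    have : a' * Real.sqrt 3 / 2 * n' 1 = 0 := by linarith
    exact (mul_eq_zero.1 this).resolve_left (by positivity)
  have f2 : (n' 2 - 1) * (n' 2 + 1) = 0 := by rw [f0, f1] at e1; nlinarith
  rcases mul_eq_zero.1 f2 with h | h
  · left; congr 1; ext l; fin_cases l <;> simp [layerNormal, f0, f1]; linarith
  · right; rw [← map_neg]; congr 1; ext l; fin_cases l <;> simp [layerNormal, f0, f1]; linarith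

/-! ## The anchor -/

/-- **Hexagon lemma.** A slot-model shell `S = p + A' M` (either type, spacing `a''`, heights `h⁺, h⁻ > 0`, any
frame `A'`) containing the regular hexagon `p ± A u, p ± A v, p ± A (u - v)` of spacing `a' > 0` of a frame `A` is
a slot model of spacing `a'` in a frame `B` with `B e₃ = A e₃` and `B = A` or `B = -A` on `u, v`. [folklore] -/
theorem stub_hexagonShell (S : Set (EuclideanSpace ℝ (Fin 3))) (p : EuclideanSpace ℝ (Fin 3))
    (a'' kp km : ℝ) (A' : EuclideanSpace ℝ (Fin 3) →ₗᵢ[ℝ] EuclideanSpace ℝ (Fin 3))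
    (ha'' : 0 < a'') (hkp : 0 < kp) (hkm : 0 < km)
    (hS : (S = Set.range fun i : Fin 12 => p + A' (slotC a'' kp km i)) ∨
      (S = Set.range fun i : Fin 12 => p + A' (slotH a'' kp km i)))
    (a' : ℝ) (A : EuclideanSpace ℝ (Fin 3) →ₗᵢ[ℝ] EuclideanSpace ℝ (Fin 3)) (ha' : 0 < a')
    (h1 : p + A (triangularVec₁ a') ∈ S) (h2 : p - A (triangularVec₁ a') ∈ S)
    (h3 : p + A (triangularVec₂ a') ∈ S) (h4 : p - A (triangularVec₂ a') ∈ S)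
    (h5 : p + A (triangularVec₁ a' - triangularVec₂ a') ∈ S)
    (h6 : p - A (triangularVec₁ a' - triangularVec₂ a') ∈ S) :
    ∃ (hp' hm' : ℝ) (B : EuclideanSpace ℝ (Fin 3) →ₗᵢ[ℝ] EuclideanSpace ℝ (Fin 3)), 0 < hp' ∧ 0 < hm' ∧
      B (layerNormal 1) = A (layerNormal 1) ∧
      ((B (triangularVec₁ a') = A (triangularVec₁ a') ∧ B (triangularVec₂ a') = A (triangularVec₂ a')) ∨
       (B (triangularVec₁ a') = -A (triangularVec₁ a') ∧ B (triangularVec₂ a') = -A (triangularVec₂ a'))) ∧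
      ((S = Set.range fun i : Fin 12 => p + B (slotC a' hp' hm' i)) ∨
       (S = Set.range fun i : Fin 12 => p + B (slotH a' hp' hm' i))) := by
  have _ := h6
  -- one statement for both types
  obtain ⟨t, hSt⟩ : ∃ t : Bool, S = Set.range fun i : Fin 12 => p + A' (laPt a'' kp km (laCode t i)) := by
    rcases hS with h | h
    · exact ⟨true, by rw [h]; exact congrArg _ (funext fun i => by rw [slotC_eq_laPt]; rfl)⟩
    · exact ⟨false, by rw [h]; exact congrArg _ (funext fun i => by rw [slotH_eq_laPt]; rfl)⟩
  obtain ⟨re, ru, rv⟩ := laHalfTurn_basis a'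
  obtain ⟨nu, nv, duv⟩ := la_norm_uv ha'
  obtain ⟨ht0, ht1, ht2⟩ := laHt_values kp km
  have idx : ∀ x : EuclideanSpace ℝ (Fin 3), p + x ∈ S → ∃ i, A' (laPt a'' kp km (laCode t i)) = x := by
    rintro x hx; rw [hSt] at hx; obtain ⟨i, hi⟩ := hx; exact ⟨i, by simpa using hi⟩
  obtain ⟨i, hi⟩ := idx _ h1
  obtain ⟨i', hi'⟩ := idx (-A (triangularVec₁ a')) (by simpa [sub_eq_add_neg] using h2)
  obtain ⟨j, hj⟩ := idx _ h3
  obtain ⟨j', hj'⟩ := idx (-A (triangularVec₂ a')) (by simpa [sub_eq_add_neg] using h4)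
  obtain ⟨k, hk⟩ := idx _ h5
  -- levels
  have lv : ∀ m, (laCode t m).2.2 = 0 ∨ (laCode t m).2.2 = 1 ∨ (laCode t m).2.2 = -1 := fun m => by
    rcases laCode_level t m with h | h | h
    exacts [Or.inl h.1, Or.inr (Or.inl h.1), Or.inr (Or.inr h.1)]
  -- norms of the three code points
  have ni : ‖laPt a'' kp km (laCode t i)‖ = a' := by rw [← A'.norm_map, hi, A.norm_map, nu]
  have nj : ‖laPt a'' kp km (laCode t j)‖ = a' := by rw [← A'.norm_map, hj, A.norm_map, nv]
  have nk : ‖laPt a'' kp km (laCode t k)‖ = a' := by rw [← A'.norm_map, hk, A.norm_map, ← dist_eq_norm, duv]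
  -- radii by level
  have rad : ∀ m, ‖laPt a'' kp km (laCode t m)‖ = a' →
      ((laCode t m).2.2 = 0 ∧ a'' = a') ∨ ((laCode t m).2.2 = 1 ∧ a'' ^ 2 / 3 + kp ^ 2 = a' ^ 2) ∨
      ((laCode t m).2.2 = -1 ∧ a'' ^ 2 / 3 + km ^ 2 = a' ^ 2) := by
    intro m hm
    rcases la_norm_code (kp := kp) (km := km) ha'' t m with ⟨hl, h⟩ | ⟨hl, h⟩ | ⟨hl, h⟩
    · exact Or.inl ⟨hl, by rw [← h, hm]⟩
    · exact Or.inr (Or.inl ⟨hl, by rw [← h, hm]⟩)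
    · exact Or.inr (Or.inr ⟨hl, by rw [← h, hm]⟩)
  -- antipodes: a cap code antipodal to a code forces cubic type and equal heights
  have anti : ∀ m m', A' (laPt a'' kp km (laCode t m')) = -A' (laPt a'' kp km (laCode t m)) →
      (laCode t m).2.2 = 0 ∨ ((laCode t m).2.2 ≠ 0 ∧ kp = km ∧ t = true) := by
    intro m m' h
    rw [← map_neg] at h
    have h' := A'.injective h
    rw [(laPt_coords a'' kp km _).1, (laPt_coords a'' kp km _).2] at h'
    obtain ⟨e1, e2, e3⟩ := la_coords ha''.ne' h'
    have p1 : (laCode t m').1 = -(laCode t m).1 := by exact_mod_cast (by linarith : ((laCode t m').1 : ℝ) = -(laCode t m).1)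
    have p2 : (laCode t m').2.1 = -(laCode t m).2.1 := by
      exact_mod_cast (by linarith : ((laCode t m').2.1 : ℝ) = -(laCode t m).2.1)
    rcases lv m with hl | hl | hl
    · exact Or.inl hl
    all_goals
      right; refine ⟨by rw [hl]; decide, ?_, ?_⟩
      · rcases lv m' with hl' | hl' | hl' <;> rw [hl, hl'] at e3 <;> simp only [ht0, ht1, ht2] at e3 <;> linarith
      · cases t
        · exact (laCodeH_no_anticap m m' (by rw [show laCode false = laCodeH from rfl] at hl; rw [hl]; decide) p1 p2).elim
        · rfl
  have Li := anti i i' (by rw [hi, hi'])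
  have Lj := anti j j' (by rw [hj, hj'])
  -- the difference `u - v`
  have hdiff : laPt a'' kp km (laCode t k) = laPt a'' kp km (laCode t i) - laPt a'' kp km (laCode t j) :=
    A'.injective (by rw [map_sub, hi, hj, hk, map_sub])
  have hdk : laHt kp km (laCode t k).2.2 = laHt kp km (laCode t i).2.2 - laHt kp km (laCode t j).2.2 ∧
      (laCode t k).1 = (laCode t i).1 - (laCode t j).1 ∧ (laCode t k).2.1 = (laCode t i).2.1 - (laCode t j).2.1 := by
    have h' : laPt a'' kp km (laCode t k) = (((laCode t i).1 : ℝ) / 3 - ((laCode t j).1 : ℝ) / 3) • triangularVec₁ a'' +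
        (((laCode t i).2.1 : ℝ) / 3 - ((laCode t j).2.1 : ℝ) / 3) • triangularVec₂ a'' +
        (laHt kp km (laCode t i).2.2 - laHt kp km (laCode t j).2.2) • layerNormal 1 := by
      rw [hdiff]; simp only [laPt]; module
    rw [(laPt_coords a'' kp km _).1] at h'
    obtain ⟨e1, e2, e3⟩ := la_coords ha''.ne' h'
    exact ⟨e3, by exact_mod_cast (by linarith : ((laCode t k).1 : ℝ) = (laCode t i).1 - (laCode t j).1),
      by exact_mod_cast (by linarith : ((laCode t k).2.1 : ℝ) = (laCode t i).2.1 - (laCode t j).2.1)⟩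
  -- CLASSIFICATION: hexagon pair, or perfect cuboctahedron
  have aa_of : ∀ m, ‖laPt a'' kp km (laCode t m)‖ = a' → (laCode t m).2.2 = 0 → a'' = a' := by
    intro m hn hl
    rcases rad m hn with ⟨-, h⟩ | ⟨h, -⟩ | ⟨h, -⟩
    · exact h
    all_goals exfalso; rw [hl] at h; exact absurd h (by decide)
  have ideal_of : ∀ m, ‖laPt a'' kp km (laCode t m)‖ = a' → (laCode t m).2.2 ≠ 0 → kp = km → a'' = a' →
      3 * kp ^ 2 = 2 * a'' ^ 2 := by
    intro m hn hl hkk haa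
    rcases rad m hn with ⟨h, -⟩ | ⟨-, h⟩ | ⟨-, h⟩
    · exact absurd h hl
    · rw [haa] at h ⊢; linarith
    · rw [haa, ← hkk] at h; rw [haa]; linarith
  have lvl0_of : ∀ m, laHt kp km (laCode t m).2.2 = 0 → (laCode t m).2.2 = 0 := by
    intro m h
    rcases lv m with hl | hl | hl
    · exact hl
    · rw [hl, ht1] at h; linarith
    · rw [hl, ht2] at h; linarith
  have hclass : ((laCode t i).2.2 = 0 ∧ (laCode t j).2.2 = 0) ∨ (t = true ∧ kp = km ∧ 3 * kp ^ 2 = 2 * a'' ^ 2) := by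
    rcases Li with hli | ⟨hli, hkk, ht'⟩
    · rcases Lj with hlj | ⟨hlj, hkk, ht'⟩
      · exact Or.inl ⟨hli, hlj⟩
      · exact Or.inr ⟨ht', hkk, ideal_of j nj hlj hkk (aa_of i ni hli)⟩
    · right; refine ⟨ht', hkk, ?_⟩
      by_cases hlj : (laCode t j).2.2 = 0
      · exact ideal_of i ni hli hkk (aa_of j nj hlj)
      · -- both are cap codes: the difference has height `0` (equal levels) or `± 2k` (impossible)
        obtain ⟨e3, -, -⟩ := hdk
        have hk0 : laHt kp km (laCode t k).2.2 = 0 := by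
          rcases lv i with h | hil | hil
          · exact absurd h hli
          all_goals
            rcases lv j with h | hjl | hjl
            · exact absurd h hlj
            all_goals
              rw [hil, hjl] at e3
              simp only [ht1, ht2] at e3
              rcases lv k with hkl | hkl | hkl <;> rw [hkl] at e3 ⊢ <;> simp only [ht0, ht1, ht2] at e3 ⊢ <;> linarith
        exact ideal_of i ni hli hkk (aa_of k nk (lvl0_of k hk0))
  rcases hclass with ⟨hli, hlj⟩ | ⟨rfl, hkk, hid⟩
  swap
  · -- PERFECT CUBOCTAHEDRON
    subst hkk
    have hS' : S = Set.range fun i : Fin 12 => p + A' (slotC a'' kp kp i) := by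
      rw [hSt]; exact congrArg _ (funext fun i => by rw [slotC_eq_laPt]; rfl)
    obtain ⟨haa, hc⟩ := cuboct_marked_edge S p a'' kp A' ha'' hkp hid hS' a' A ha' h1 h3
    rcases hc with hc | hc
    · exact ⟨kp, kp, A, hkp, hkp, rfl, Or.inl ⟨rfl, rfl⟩, Or.inl hc⟩
    · refine ⟨kp, kp, A.comp laHalfTurn.toLinearIsometry, hkp, hkp, by simp [re], Or.inr ⟨by simp [ru], by simp [rv]⟩,
        Or.inl ?_⟩
      rw [hc]; rfl
  · -- HEXAGON PAIR
    obtain ⟨-, haa⟩ | ⟨h, -⟩ | ⟨h, -⟩ := rad i ni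
    rotate_left
    · exact absurd h (by rw [hli]; decide)
    · exact absurd h (by rw [hli]; decide)
    subst haa
    obtain ⟨e3, dk1, dk2⟩ := hdk
    have hlk : (laCode t k).2.2 = 0 := by
      rw [hli, hlj, ht0, sub_zero] at e3
      exact lvl0_of k (by rw [e3])
    have hpair : laHexPair t i j = true := by
      simp only [laHexPair, Bool.and_eq_true, beq_iff_eq, List.any_eq_true]
      exact ⟨⟨hli, hlj⟩, k, List.mem_finRange k, ⟨hlk, dk1⟩, dk2⟩
    -- the unit normal
    have hn : A' (layerNormal 1) = A (layerNormal 1) ∨ A' (layerNormal 1) = -A (layerNormal 1) := by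
      have ne : ‖(layerNormal 1 : EuclideanSpace ℝ (Fin 3))‖ = 1 := by
        rw [EuclideanSpace.norm_eq, Fin.sum_univ_three]; simp [layerNormal]
      refine unit_normal_eq ha'' A _ (by rw [A'.norm_map, ne]) ?_ ?_
      · rw [← hi, A'.inner_map_map, real_inner_comm, inner_laPt_layerNormal, hli, ht0]
      · rw [← hj, A'.inner_map_map, real_inner_comm, inner_laPt_layerNormal, hlj, ht0]
    obtain ⟨s, hs⟩ : ∃ s : Bool, A' (layerNormal 1) = (laSgn s : ℝ) • A (layerNormal 1) := by
      rcases hn with h | h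
      · exact ⟨true, by rw [h]; simp [laSgn]⟩
      · exact ⟨false, by rw [h]; simp [laSgn]⟩
    -- heights of the new frame
    obtain ⟨hp', hm', hpos, hht⟩ : ∃ hp' hm' : ℝ, (0 < hp' ∧ 0 < hm') ∧
        ∀ l : ℤ, (l = 0 ∨ l = 1 ∨ l = -1) → (laSgn s : ℝ) * laHt kp km l = laHt hp' hm' (laSgn s * l) := by
      cases s
      · refine ⟨km, kp, ⟨hkm, hkp⟩, fun l hl => ?_⟩
        rcases hl with rfl | rfl | rfl <;> simp [laSgn, laHt]
      · refine ⟨kp, km, ⟨hkp, hkm⟩, fun l hl => ?_⟩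
        rcases hl with rfl | rfl | rfl <;> simp [laSgn, laHt]
    -- the bridge: a re-expanded code point in the frame `A`
    have bridge : ∀ (m : Fin 12) (c' : ℤ × ℤ × ℤ), laHexRel t s i j m c' = true →
        A' (laPt a'' kp km (laCode t m)) = A (laPt a'' hp' hm' c') := by
      intro m c' hrel
      simp only [laHexRel, Bool.and_eq_true, beq_iff_eq] at hrel
      obtain ⟨⟨r1, r2⟩, r3⟩ := hrel
      have q1 : ((laCode t m).1 : ℝ) / 3 = (c'.1 : ℝ) / 3 * (((laCode t i).1 : ℝ) / 3) + (c'.2.1 : ℝ) / 3 * (((laCode t j).1 : ℝ) / 3) := by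
        have : (3 * (laCode t m).1 : ℝ) = c'.1 * (laCode t i).1 + c'.2.1 * (laCode t j).1 := by exact_mod_cast r1
        linarith
      have q2 : ((laCode t m).2.1 : ℝ) / 3 = (c'.1 : ℝ) / 3 * (((laCode t i).2.1 : ℝ) / 3) + (c'.2.1 : ℝ) / 3 * (((laCode t j).2.1 : ℝ) / 3) := by
        have : (3 * (laCode t m).2.1 : ℝ) = c'.1 * (laCode t i).2.1 + c'.2.1 * (laCode t j).2.1 := by exact_mod_cast r2
        linarith
      have em : laPt a'' kp km (laCode t m) = ((c'.1 : ℝ) / 3) • laPt a'' kp km (laCode t i) +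
          ((c'.2.1 : ℝ) / 3) • laPt a'' kp km (laCode t j) + laHt kp km (laCode t m).2.2 • layerNormal 1 := by
        simp only [laPt, hli, hlj, ht0, zero_smul, add_zero]
        rw [q1, q2]; module
      have ec : laPt a'' hp' hm' c' = ((c'.1 : ℝ) / 3) • triangularVec₁ a'' + ((c'.2.1 : ℝ) / 3) • triangularVec₂ a'' +
          ((laSgn s : ℝ) * laHt kp km (laCode t m).2.2) • layerNormal 1 := by
        rw [hht _ (lv m), ← r3]; rfl
      rw [em, ec]
      simp only [map_add, LinearIsometry.map_smul, hi, hj, hs, smul_smul, mul_comm]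
    -- conclusion, in the frame `A` or `A ∘ R_π`
    have fin : ∀ B : EuclideanSpace ℝ (Fin 3) →ₗᵢ[ℝ] EuclideanSpace ℝ (Fin 3),
        (S = Set.range fun m : Fin 12 => p + B (laPt a'' hp' hm' (laCode t m))) →
        ((S = Set.range fun i : Fin 12 => p + B (slotC a'' hp' hm' i)) ∨
          (S = Set.range fun i : Fin 12 => p + B (slotH a'' hp' hm' i))) := by
      intro B hB
      cases t
      · right; rw [hB]; exact congrArg _ (funext fun i => by rw [slotH_eq_laPt]; rfl)
      · left; rw [hB]; exact congrArg _ (funext fun i => by rw [slotC_eq_laPt]; rfl)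
    rcases laHex_transport t s i j hpair with ⟨fwd, bwd⟩ | ⟨fwd, bwd⟩
    · refine ⟨hp', hm', A, hpos.1, hpos.2, rfl, Or.inl ⟨rfl, rfl⟩, fin A ?_⟩
      rw [hSt]; ext x; simp only [Set.mem_range]
      constructor
      · rintro ⟨m, rfl⟩; obtain ⟨m', hm'⟩ := fwd m; exact ⟨m', by rw [bridge m _ hm']⟩
      · rintro ⟨m', rfl⟩; obtain ⟨m, hm⟩ := bwd m'; exact ⟨m, by rw [bridge m _ hm]⟩
    · refine ⟨hp', hm', A.comp laHalfTurn.toLinearIsometry, hpos.1, hpos.2, by simp [re],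
        Or.inr ⟨by simp [ru], by simp [rv]⟩, fin _ ?_⟩
      rw [hSt]; ext x
      simp only [Set.mem_range, LinearIsometry.coe_comp, Function.comp_apply, LinearIsometryEquiv.coe_toLinearIsometry,
        laHalfTurn_laPt]
      constructor
      · rintro ⟨m, rfl⟩; obtain ⟨m', hm'⟩ := fwd m; exact ⟨m', by rw [bridge m _ hm']⟩
      · rintro ⟨m', rfl⟩; obtain ⟨m, hm⟩ := bwd m'; exact ⟨m, by rw [bridge m _ hm]⟩

end Summit.AtomisticToContinuum.Crystallization.Theorems.CleanHull

end
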